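import Summits.Ventures.CertifiedManyBodySolver.Theorems.M3x2EdgeSplitSymReplayOracleCanon
import HarnessLib

/-!
# SymReplay — E5 «ORACLE CANON» (part 2 of 2: (c)(d)(e)): box form, executed closed-form-move form, kernel demo

(pen hub-lb-sym-plan-1 g4 text `e5/OracleCanon_land.lean` 49f82e5b23065576, sections (c)–(e) verbatim; split by the lander
hub-lb-sym-eng-3 g2 at the (b)/(c) boundary because the gate caps Theorems files with proofs at 400 lines; part 1 = `…OracleCanon`
((a) hints + `canonTermHW_sound` + hinted pipe, (b) OUTROUTE plumbing + `energyDensity_ge_of_outrouteH`); the module docstring of part 1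
describes the whole.)  CONTENTS here: (c) BOX form under `boxLicence`: `partnerOfB`, `canonTermHWB`, `canonNFZHB`, `outOKHB` / `OutFactsHB`
with their `_eq` lemmas and `energyDensity_ge_of_outrouteHB`; (d) the EXECUTED form with the closed-form move of `…BoxCanonZ`:
`partnerOfBZ`, `canonTermHWBZ`, `canonNFZHBZ`, `outOKHBZ` / `OutFactsHBZ`, equal to (c) as functions, and the closing
`energyDensity_ge_of_outrouteHBZ` (CLOSING GRAMMAR in part 1); (e) kernel demo.
HONEST FRAMING: checker plumbing; no oracle is defined here and no certificate is replayed; no bound of record moves; no summit or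
crux statement is proved; nothing here predicts superconductivity.
-/

namespace Summit.Ventures.CertifiedManyBodySolver.Theorems.SymReplay

open Literature.MathematicalPhysics.QuantumLattice
open Literature.MathematicalPhysics.QuantumLattice.HubbardWave0
open Literature.MathematicalPhysics.QuantumLattice.ThermodynamicLimit
open Literature.Probability.LatticeModels
open Literature.MathematicalPhysics.QuantumManyBody.StateRelaxation
open Summit.Ventures.CertifiedManyBodySolver.Theorems.WardSlot
/-! ##### (c) Box form (path of record for box frames; twin of `…OutRoute` §Box-canon form): the licence test is the O(|w|) `inBox lo hi`; under `boxLicence frame lo hi` every box object IS the frame object -/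

/-- Validated partner, box form. -/
def partnerOfB (lo hi : ℤ × ℤ) (h : HintT) (u : Word) : Option (DihedralGroup 4 × Site 2) :=
  match h.partner with
  | none => none
  | some p =>
    if inBox lo hi (moveWordV p.1 p.2 u) && polyNegEq (nfWord (moveWordV h.γ h.v u)) (nfWord (moveWordV p.1 p.2 u))
    then some p else none

/-- Hinted term canon, box form. -/
def canonTermHWB (lo hi : ℤ × ℤ) (h : HintT) (t : ℚ × Word) : QPoly :=
  if inBox lo hi (moveWordV h.γ h.v t.2) then
    match partnerOfB lo hi h t.2 with
    | some _ => []
    | none => pscale t.1 (nfWord (moveWordV h.γ h.v t.2))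
  else [t]

/-- Hinted zero-filtered pipe, box form. -/
def canonNFZHB (lo hi : ℤ × ℤ) (oracle : Word → HintT) (p : QPoly) : QPoly :=
  (dropZeros (collect (nfPoly p))).flatMap fun t => canonTermHWB lo hi (oracle t.2) t

/-- Per-module fact, box form. -/
def outOKHB (K : SymCertR) (oracle : Word → HintT) (κ : Word → ℕ) (J : ℕ) (lo hi : ℤ × ℤ) (i : ℕ) : Bool :=
  isZero (canonNFZHB lo hi oracle (shareR K κ J i))

/-- The per-module facts, box form. -/
def OutFactsHB (K : SymCertR) (oracle : Word → HintT) (κ : Word → ℕ) (J : ℕ) (lo hi : ℤ × ℤ) : ℕ → ℕ → Prop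
  | _, 0 => True
  | i, n + 1 => outOKHB K oracle κ J lo hi i = true ∧ OutFactsHB K oracle κ J lo hi (i + 1) n

/-- Under the licence the box partner test IS the frame-list test. -/
theorem partnerOfB_eq {frame : List (Site 2)} {lo hi : ℤ × ℤ} (hb : boxLicence frame lo hi = true) (h : HintT) (u : Word) :
    partnerOfB lo hi h u = partnerOf frame h u := by
  unfold partnerOfB partnerOf
  cases h.partner with
  | none => rfl
  | some p => simp only [moveWordV_eq, inBox_eq_suppIn hb]

/-- Under the licence the box term canon IS the frame-list term canon. -/
theorem canonTermHWB_eq {frame : List (Site 2)} {lo hi : ℤ × ℤ} (hb : boxLicence frame lo hi = true) (h : HintT) (t : ℚ × Word) :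
    canonTermHWB lo hi h t = canonTermHW frame h t := by
  unfold canonTermHWB canonTermHW
  rw [partnerOfB_eq hb, moveWordV_eq, inBox_eq_suppIn hb]
  cases partnerOf frame h t.2 <;> rfl

/-- Under the licence the box pipe IS the frame-list pipe. -/
theorem canonNFZHB_eq {frame : List (Site 2)} {lo hi : ℤ × ℤ} (hb : boxLicence frame lo hi = true)
    (oracle : Word → HintT) (p : QPoly) : canonNFZHB lo hi oracle p = canonNFZH frame oracle p := by
  unfold canonNFZHB canonNFZH canonTermH
  simp only [canonTermHWB_eq hb]

/-- Under the licence the box fact IS the frame-list fact. -/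
theorem outOKHB_eq (K : SymCertR) (oracle : Word → HintT) (κ : Word → ℕ) (J : ℕ) {lo hi : ℤ × ℤ}
    (hb : boxLicence K.frame lo hi = true) (i : ℕ) : outOKHB K oracle κ J lo hi i = outOKH K oracle κ J i := by
  rw [outOKHB, outOKH, canonNFZHB_eq hb]

/-- Box facts give frame-list facts. -/
theorem outFactsH_of_B (K : SymCertR) (oracle : Word → HintT) (κ : Word → ℕ) (J : ℕ) {lo hi : ℤ × ℤ}
    (hb : boxLicence K.frame lo hi = true) :
    ∀ (n i : ℕ), OutFactsHB K oracle κ J lo hi i n → OutFactsH K oracle κ J i n := by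
  intro n
  induction n with
  | zero => intro i _; exact trivial
  | succ n ih => intro i hf; exact ⟨(outOKHB_eq K oracle κ J hb i).symm.trans hf.1, ih (i + 1) hf.2⟩

/-- **E5 closing, box form**: CLOSING GRAMMAR per module `i < J` one file
`theorem out_i : outOKHB K oracle κ J lo hi i = true := by native_decide` (the oracle — e.g. sym-ref-1 g1's packed `canonPH` through
an adapter `Hint → HintT`, `k ↦ γof k`, `(amin, bmin) ↦ mkSite (−amin) (−bmin)` — runs INSIDE this evaluation; no hint data is shipped),
then `hfacts : OutFactsHB K oracle κ J lo hi 0 J := ⟨out_0, …, out_{J−1}, trivial⟩`. -/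
theorem energyDensity_ge_of_outrouteHB (K : SymCertR) (hwf : wellFormed K.expand = true)
    (hRok : K.gramR.all (gramBlockROK K.frame) = true) (oracle : Word → HintT) (κ : Word → ℕ) (J : ℕ) (hJ : 0 < J)
    (lo hi : ℤ × ℤ) (hbox : boxLicence K.frame lo hi = true) (hfacts : OutFactsHB K oracle κ J lo hi 0 J) :
    ((symValueR K : ℚ) : ℝ) ≤ energyDensityTT' 1 0 8 (7 / 8) :=
  energyDensity_ge_of_outrouteH K hwf hRok oracle κ J hJ (outFactsH_of_B K oracle κ J hbox J 0 hfacts)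

/-! ##### (d) Executed form: the closed-form move of `…BoxCanonZ` in every licence test and image (equal to (c) as functions) -/

/-- Validated partner, executed form. -/
def partnerOfBZ (lo hi : ℤ × ℤ) (h : HintT) (u : Word) : Option (DihedralGroup 4 × Site 2) :=
  match h.partner with
  | none => none
  | some p =>
    if inBox lo hi (moveWordZ p.1 p.2 u) && polyNegEq (nfWord (moveWordZ h.γ h.v u)) (nfWord (moveWordZ p.1 p.2 u))
    then some p else none

/-- Hinted term canon, executed form. -/
def canonTermHWBZ (lo hi : ℤ × ℤ) (h : HintT) (t : ℚ × Word) : QPoly :=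
  if inBox lo hi (moveWordZ h.γ h.v t.2) then
    match partnerOfBZ lo hi h t.2 with
    | some _ => []
    | none => pscale t.1 (nfWord (moveWordZ h.γ h.v t.2))
  else [t]

/-- Hinted zero-filtered pipe, executed form. -/
def canonNFZHBZ (lo hi : ℤ × ℤ) (oracle : Word → HintT) (p : QPoly) : QPoly :=
  (dropZeros (collect (nfPoly p))).flatMap fun t => canonTermHWBZ lo hi (oracle t.2) t

/-- **Per-module fact, executed form** (the `native_decide` target). -/
def outOKHBZ (K : SymCertR) (oracle : Word → HintT) (κ : Word → ℕ) (J : ℕ) (lo hi : ℤ × ℤ) (i : ℕ) : Bool :=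
  isZero (canonNFZHBZ lo hi oracle (shareR K κ J i))

/-- The per-module facts, executed form. -/
def OutFactsHBZ (K : SymCertR) (oracle : Word → HintT) (κ : Word → ℕ) (J : ℕ) (lo hi : ℤ × ℤ) : ℕ → ℕ → Prop
  | _, 0 => True
  | i, n + 1 => outOKHBZ K oracle κ J lo hi i = true ∧ OutFactsHBZ K oracle κ J lo hi (i + 1) n

/-- `partnerOfBZ = partnerOfB`. -/
theorem partnerOfBZ_eq : partnerOfBZ = partnerOfB := by
  funext lo hi h u; unfold partnerOfBZ partnerOfB; simp only [moveWordZ_eq']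

/-- `canonTermHWBZ = canonTermHWB`. -/
theorem canonTermHWBZ_eq : canonTermHWBZ = canonTermHWB := by
  funext lo hi h t; unfold canonTermHWBZ canonTermHWB; simp only [moveWordZ_eq', partnerOfBZ_eq]

/-- `canonNFZHBZ = canonNFZHB`. -/
theorem canonNFZHBZ_eq : canonNFZHBZ = canonNFZHB := by
  funext lo hi oracle p; unfold canonNFZHBZ canonNFZHB; simp only [canonTermHWBZ_eq]

/-- `outOKHBZ = outOKHB`. -/
theorem outOKHBZ_eq : outOKHBZ = outOKHB := by
  funext K oracle κ J lo hi i; rw [outOKHBZ, outOKHB, canonNFZHBZ_eq]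

/-- Executed facts give box facts. -/
theorem outFactsHB_of_Z (K : SymCertR) (oracle : Word → HintT) (κ : Word → ℕ) (J : ℕ) (lo hi : ℤ × ℤ) :
    ∀ (n i : ℕ), OutFactsHBZ K oracle κ J lo hi i n → OutFactsHB K oracle κ J lo hi i n := by
  intro n
  induction n with
  | zero => intro i _; exact trivial
  | succ n ih =>
    intro i hf
    exact ⟨by rw [← hf.1, outOKHBZ_eq], ih (i + 1) hf.2⟩

/-- **E5 closing, executed form**: per module `i < J` one file `theorem out_i : outOKHBZ K oracle κ J lo hi i = true := by native_decide`,
then `hfacts := ⟨out_0, …, out_{J−1}, trivial⟩`. -/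
theorem energyDensity_ge_of_outrouteHBZ (K : SymCertR) (hwf : wellFormed K.expand = true)
    (hRok : K.gramR.all (gramBlockROK K.frame) = true) (oracle : Word → HintT) (κ : Word → ℕ) (J : ℕ) (hJ : 0 < J)
    (lo hi : ℤ × ℤ) (hbox : boxLicence K.frame lo hi = true) (hfacts : OutFactsHBZ K oracle κ J lo hi 0 J) :
    ((symValueR K : ℚ) : ℝ) ≤ energyDensityTT' 1 0 8 (7 / 8) :=
  energyDensity_ge_of_outrouteHB K hwf hRok oracle κ J hJ lo hi hbox (outFactsHB_of_Z K oracle κ J lo hi J 0 hfacts)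

/-! ##### (e) Kernel demo: one word, a hand hint; the verified step is the tree's `nfWord` of the moved word -/

/-- Demo word `c†_{(1,0),↑} c_{(0,−1),↑}`. -/
def demoWordE5 : Word := [⟨mkSite 1 0, 0, true⟩, ⟨mkSite 0 (-1), 0, false⟩]

/-- Demo hint: rotate by `r 1`, translate by `(−11, −12)`, no zero claim. -/
def demoHintE5 : HintT := ⟨.r 1, mkSite (-11) (-12), none⟩

example : inBox ((-12 : ℤ), (-12 : ℤ)) ((12 : ℤ), (12 : ℤ)) (moveWordZ demoHintE5.γ demoHintE5.v demoWordE5) = true := by decide +kernel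
example : (canonTermHWBZ ((-12 : ℤ), (-12 : ℤ)) ((12 : ℤ), (12 : ℤ)) demoHintE5 ((3 : ℚ), demoWordE5)).length = 1 := by decide +kernel
/-- An unlicensed hint leaves the term unchanged (so the module fact fails rather than certifying anything). -/
example : (match canonTermHWBZ ((-12 : ℤ), (-12 : ℤ)) ((12 : ℤ), (12 : ℤ)) ⟨.r 0, mkSite 100 0, none⟩ ((3 : ℚ), demoWordE5) with
    | [(q, w)] => decide (q = 3) && wordEq w demoWordE5
    | _ => false) = true := by decide +kernel

end Summit.Ventures.CertifiedManyBodySolver.Theorems.SymReplay
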